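import Mathlib.Analysis.Normed.Module.Basic
import Mathlib.Analysis.Normed.Group.Uniform
import Mathlib.Topology.MetricSpace.ProperSpace.Real
import Mathlib.Topology.Algebra.Module.Basic
import Mathlib.Topology.ContinuousOn
import HarnessLib

/-!
# Cone coordinates on a square and the cone interpolation of boundary data

Topic: the `2`-cell step of the `C⁰` general ("cone") position of a disc with respect to a
`C⁰` codimension-one foliation (`TautFoliations*.lean`; Camacho–Lins Neto, *Geometric Theory
of Foliations*, Ch. VI §3, Prop. 1, where a map `A : D² → M` is modified box by box keeping
its values near the boundary of each piece). In the `C⁰` setting a map given on the boundary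
of a small square `Q` (mapped into one flow box) is extended over `Q` by **coning in the
coordinates of the box**: the point at radial parameter `r ∈ [0, 1]` on the ray from the centre
`c` to the boundary point `q` is sent to the convex combination `(1 - r) • v₀ + r • φ q` of a
centre value `v₀` and the boundary value `φ q`. This file provides the elementary geometry:

* `ConeSquare.radial c ℓ x = dist x c / ℓ` and `ConeSquare.proj c ℓ x` (**definitions**): the
  cone (radial) coordinates of `x` in the square `closedBall c ℓ` of the plane `ℝ × ℝ` with
  its max norm (so that metric balls *are* squares and `sphere c ℓ` is the boundary of the
  square); `x = c + radial x • (proj x - c)` (`eq_center_add_radial_smul`), `radial = 1` and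
  `proj = id` on the boundary, `proj x ∈ sphere c ℓ`.
* `ConeSquare.cone c ℓ v₀ φ` (**definition**): the cone interpolation
  `x ↦ (1 - radial x) • v₀ + radial x • φ (proj x)` with values in a real normed space; it
  equals `φ` on the boundary (`cone_of_mem_sphere`), `v₀` at the centre (`cone_center`), is
  affine along each ray (`cone_ray`), and is **continuous on the square when `φ` is continuous
  on its boundary** (`continuousOn_cone`).
* For values in a product `V × ℝ` (flow box coordinates `B × ℝ`) the height of the cone is the
  cone of the heights (`snd_cone`): along the ray to `q` it is the affine function
  `(1 - r) m + r (φ q).2` — the source of the explicit level-set structure of the induced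
  singular foliation of the square.

## References

* C. Camacho, A. Lins Neto, *Geometric Theory of Foliations*, Birkhäuser (1985), Ch. VI §3,
  Prop. 1 [CamachoLinsNeto1985].

## Design notes

* The plane is `ℝ × ℝ` with Mathlib's max norm; squares are `Metric.closedBall c ℓ`. Pure
  elementary analysis (Mathlib only).
-/
open Set Filter Metric Topology

namespace Literature.Topology.FourManifolds

namespace ConeSquare

variable {V : Type*} [NormedAddCommGroup V] [NormedSpace ℝ V]

-- BODY
/-! ## Cone (radial) coordinates on a square -/

/-- The **radial coordinate** of `x` in the square of centre `c` and half-side `ℓ`: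
`dist x c / ℓ`, equal to `0` at the centre and to `1` on the boundary. [folklore] -/
noncomputable def radial (c : ℝ × ℝ) (ℓ : ℝ) (x : ℝ × ℝ) : ℝ := dist x c / ℓ

/-- The **radial projection** of `x ≠ c` to the boundary of the square of centre `c` and
half-side `ℓ` (in the max norm of `ℝ × ℝ`); at the centre, a fixed boundary point. [folklore] -/
noncomputable def proj (c : ℝ × ℝ) (ℓ : ℝ) (x : ℝ × ℝ) : ℝ × ℝ := by
  classical
  exact if x = c then c + (ℓ, 0) else c + (ℓ / dist x c) • (x - c)

variable {c : ℝ × ℝ} {ℓ : ℝ} {x : ℝ × ℝ}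

/-- Unfolding lemma for `radial`. [folklore] -/
theorem radial_def (c : ℝ × ℝ) (ℓ : ℝ) (x : ℝ × ℝ) : radial c ℓ x = dist x c / ℓ := rfl

/-- The radial coordinate of the centre is `0`. [folklore] -/
@[simp] theorem radial_center (c : ℝ × ℝ) (ℓ : ℝ) : radial c ℓ c = 0 := by simp [radial]

/-- On the boundary of the square the radial coordinate is `1`. [folklore] -/
theorem radial_of_mem_sphere (hℓ : 0 < ℓ) (hx : x ∈ sphere c ℓ) : radial c ℓ x = 1 := by
  rw [mem_sphere] at hx
  rw [radial, hx, div_self hℓ.ne']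

/-- In the square the radial coordinate lies in `[0, 1]`. [folklore] -/
theorem radial_mem_Icc (hℓ : 0 < ℓ) (hx : x ∈ closedBall c ℓ) : radial c ℓ x ∈ Icc (0 : ℝ) 1 := by
  rw [mem_closedBall] at hx
  exact ⟨div_nonneg dist_nonneg hℓ.le, (div_le_one hℓ).2 hx⟩

/-- The radial coordinate is nonnegative. [folklore] -/
theorem radial_nonneg (hℓ : 0 < ℓ) (x : ℝ × ℝ) : 0 ≤ radial c ℓ x := div_nonneg dist_nonneg hℓ.le

/-- The radial coordinate is continuous. [folklore] -/
theorem continuous_radial (c : ℝ × ℝ) (ℓ : ℝ) : Continuous (radial c ℓ) :=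
  (continuous_id.dist continuous_const).div_const _

/-- The radial coordinate is bounded by `radial` times the half-side: `dist x c = ℓ * radial x`.
[folklore] -/
theorem dist_eq_mul_radial (hℓ : 0 < ℓ) (x : ℝ × ℝ) : dist x c = ℓ * radial c ℓ x := by
  rw [radial, mul_div_cancel₀ _ hℓ.ne']

/-- The projection of a point other than the centre. [folklore] -/
theorem proj_of_ne (hx : x ≠ c) : proj c ℓ x = c + (ℓ / dist x c) • (x - c) := by
  classical
  simp [proj, hx]

/-- The projection of the centre is the chosen boundary point `c + (ℓ, 0)`. [folklore] -/
@[simp] theorem proj_center (c : ℝ × ℝ) (ℓ : ℝ) : proj c ℓ c = c + (ℓ, 0) := by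
  classical
  simp [proj]

/-- **The projection lands on the boundary of the square.** [folklore] -/
theorem proj_mem_sphere (hℓ : 0 < ℓ) (x : ℝ × ℝ) : proj c ℓ x ∈ sphere c ℓ := by
  classical
  by_cases hx : x = c
  · subst hx
    rw [proj_center, mem_sphere, dist_eq_norm, add_sub_cancel_left, Prod.norm_def]
    simp [abs_of_pos hℓ, hℓ.le]
  · have hd : 0 < dist x c := dist_pos.2 hx
    rw [proj_of_ne hx, mem_sphere, dist_eq_norm, add_sub_cancel_left, norm_smul, Real.norm_eq_abs,
      abs_of_pos (div_pos hℓ hd), ← dist_eq_norm, div_mul_cancel₀ _ hd.ne']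

/-- On the boundary of the square the projection is the identity. [folklore] -/
theorem proj_of_mem_sphere (hℓ : 0 < ℓ) (hx : x ∈ sphere c ℓ) : proj c ℓ x = x := by
  have hxc : x ≠ c := by
    rintro rfl
    rw [mem_sphere, dist_self] at hx
    exact hℓ.ne' hx.symm
  rw [mem_sphere] at hx
  rw [proj_of_ne hxc, hx, div_self hℓ.ne', one_smul, add_sub_cancel]

/-- **Cone coordinates**: every point of the plane is `c + radial x • (proj x - c)`. [folklore] -/
theorem eq_center_add_radial_smul (hℓ : 0 < ℓ) (x : ℝ × ℝ) :
    x = c + radial c ℓ x • (proj c ℓ x - c) := by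
  classical
  by_cases hx : x = c
  · subst hx
    simp
  · have hd : 0 < dist x c := dist_pos.2 hx
    rw [proj_of_ne hx, add_sub_cancel_left, smul_smul, radial]
    have : dist x c / ℓ * (ℓ / dist x c) = 1 := by
      field_simp
    rw [this, one_smul, add_sub_cancel]

/-- The projection is continuous away from the centre. [folklore] -/
theorem continuousOn_proj (c : ℝ × ℝ) (ℓ : ℝ) : ContinuousOn (proj c ℓ) {c}ᶜ := by
  have h1 : ContinuousOn (fun x : ℝ × ℝ ↦ ℓ / dist x c) {c}ᶜ :=
    continuousOn_const.div (continuous_id.dist continuous_const).continuousOn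
      fun x hx ↦ (dist_pos.2 hx).ne'
  have h : ContinuousOn (fun x : ℝ × ℝ ↦ c + (ℓ / dist x c) • (x - c)) {c}ᶜ :=
    continuousOn_const.add (h1.smul (continuous_id.sub continuous_const).continuousOn)
  exact h.congr fun x hx ↦ proj_of_ne hx

/-- Points of a ray: for `q` on the boundary and `t ∈ (0, 1]`… in fact for all `t > 0`, the
point `c + t • (q - c)` has radial coordinate `t` and projection `q`. [folklore] -/
theorem radial_ray (hℓ : 0 < ℓ) {q : ℝ × ℝ} (hq : q ∈ sphere c ℓ) {t : ℝ} (ht : 0 ≤ t) :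
    radial c ℓ (c + t • (q - c)) = t := by
  rw [mem_sphere, dist_eq_norm] at hq
  rw [radial, dist_eq_norm, add_sub_cancel_left, norm_smul, Real.norm_eq_abs, abs_of_nonneg ht, hq,
    mul_div_cancel_right₀ _ hℓ.ne']

/-- The projection of a point of the ray to `q` (other than the centre) is `q`. [folklore] -/
theorem proj_ray (hℓ : 0 < ℓ) {q : ℝ × ℝ} (hq : q ∈ sphere c ℓ) {t : ℝ} (ht : 0 < t) :
    proj c ℓ (c + t • (q - c)) = q := by
  have hq' := hq
  rw [mem_sphere, dist_eq_norm] at hq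
  have hne : c + t • (q - c) ≠ c := by
    intro h
    rw [add_eq_left, smul_eq_zero, sub_eq_zero] at h
    rcases h with h | h
    · exact ht.ne' h
    · rw [h, sub_self, norm_zero] at hq
      exact hℓ.ne' hq.symm
  rw [proj_of_ne hne, add_sub_cancel_left, dist_eq_norm, add_sub_cancel_left, norm_smul,
    Real.norm_eq_abs, abs_of_pos ht, hq, smul_smul]
  have : ℓ / (t * ℓ) * t = 1 := by
    field_simp
  rw [this, one_smul, add_sub_cancel]

/-! ## The cone interpolation -/

/-- **The cone interpolation** of the boundary data `φ` (used on the boundary `sphere c ℓ` of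
the square) and the centre value `v₀`: `x ↦ (1 - radial x) • v₀ + radial x • φ (proj x)`,
affine along each ray from the centre value to the boundary value. [folklore] -/
noncomputable def cone (c : ℝ × ℝ) (ℓ : ℝ) (v₀ : V) (φ : ℝ × ℝ → V) (x : ℝ × ℝ) : V :=
  (1 - radial c ℓ x) • v₀ + radial c ℓ x • φ (proj c ℓ x)

variable {v₀ : V} {φ : ℝ × ℝ → V}

/-- Unfolding lemma for `cone`. [folklore] -/
theorem cone_apply (c : ℝ × ℝ) (ℓ : ℝ) (v₀ : V) (φ : ℝ × ℝ → V) (x : ℝ × ℝ) :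
    cone c ℓ v₀ φ x = (1 - radial c ℓ x) • v₀ + radial c ℓ x • φ (proj c ℓ x) := rfl

/-- **The cone equals the boundary data on the boundary.** [folklore] -/
theorem cone_of_mem_sphere (hℓ : 0 < ℓ) (hx : x ∈ sphere c ℓ) : cone c ℓ v₀ φ x = φ x := by
  rw [cone_apply, radial_of_mem_sphere hℓ hx, proj_of_mem_sphere hℓ hx, sub_self, zero_smul,
    one_smul, zero_add]

/-- **The cone equals the centre value at the centre.** [folklore] -/
@[simp] theorem cone_center (c : ℝ × ℝ) (ℓ : ℝ) (v₀ : V) (φ : ℝ × ℝ → V) : cone c ℓ v₀ φ c = v₀ := by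
  rw [cone_apply, radial_center, sub_zero, one_smul, zero_smul, add_zero]

/-- **The cone is affine along each ray**: at the point of parameter `t ∈ (0, ∞)` of the ray
from the centre to the boundary point `q`, its value is `(1 - t) • v₀ + t • φ q`. [folklore] -/
theorem cone_ray (hℓ : 0 < ℓ) {q : ℝ × ℝ} (hq : q ∈ sphere c ℓ) {t : ℝ} (ht : 0 < t) :
    cone c ℓ v₀ φ (c + t • (q - c)) = (1 - t) • v₀ + t • φ q := by
  rw [cone_apply, radial_ray hℓ hq ht.le, proj_ray hℓ hq ht]

/-- The cone along a ray, including the centre (`t = 0`). [folklore] -/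
theorem cone_ray_of_nonneg (hℓ : 0 < ℓ) {q : ℝ × ℝ} (hq : q ∈ sphere c ℓ) {t : ℝ} (ht : 0 ≤ t) :
    cone c ℓ v₀ φ (c + t • (q - c)) = (1 - t) • v₀ + t • φ q := by
  rcases ht.eq_or_lt with rfl | ht
  · simp
  · exact cone_ray hℓ hq ht

/-- **The height of a cone is the cone of the heights**: for values in a product `W × ℝ` (the
coordinates `B × ℝ` of a flow box), the second component of the cone interpolation is the real
cone interpolation of the second components — along the ray to `q` the affine function
`(1 - r) m + r (φ q).2`. [folklore] -/
theorem snd_cone {W : Type*} [NormedAddCommGroup W] [NormedSpace ℝ W] (c : ℝ × ℝ) (ℓ : ℝ)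
    (w₀ : W × ℝ) (ψ : ℝ × ℝ → W × ℝ) (x : ℝ × ℝ) :
    (cone c ℓ w₀ ψ x).2 = (1 - radial c ℓ x) * w₀.2 + radial c ℓ x * (ψ (proj c ℓ x)).2 := by
  simp [cone_apply, smul_eq_mul]

/-- The height of a cone along a ray. [folklore] -/
theorem snd_cone_ray {W : Type*} [NormedAddCommGroup W] [NormedSpace ℝ W] (hℓ : 0 < ℓ) (w₀ : W × ℝ)
    (ψ : ℝ × ℝ → W × ℝ) {q : ℝ × ℝ} (hq : q ∈ sphere c ℓ) {t : ℝ} (ht : 0 ≤ t) :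
    (cone c ℓ w₀ ψ (c + t • (q - c))).2 = (1 - t) * w₀.2 + t * (ψ q).2 := by
  rw [cone_ray_of_nonneg hℓ hq ht]
  simp [smul_eq_mul]

/-! ## Continuity of the cone interpolation -/

/-- The cone is continuous on the square away from the centre, when the boundary data are
continuous on the boundary. [folklore] -/
theorem continuousOn_cone_diff (hℓ : 0 < ℓ) (hφ : ContinuousOn φ (sphere c ℓ)) :
    ContinuousOn (cone c ℓ v₀ φ) {c}ᶜ := by
  refine ((continuousOn_const.sub (continuous_radial c ℓ).continuousOn).smul continuousOn_const).add
    ((continuous_radial c ℓ).continuousOn.smul (hφ.comp (continuousOn_proj c ℓ)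
      fun x _ ↦ proj_mem_sphere hℓ x))

/-- **The cone interpolation is continuous on the square** when the boundary data are
continuous on the boundary: away from the centre by the continuity of the cone coordinates,
and at the centre because `‖cone x - v₀‖ ≤ radial x · sup ‖φ - v₀‖` over the (compact)
boundary. [folklore] -/
theorem continuousOn_cone (hℓ : 0 < ℓ) (hφ : ContinuousOn φ (sphere c ℓ)) :
    ContinuousOn (cone c ℓ v₀ φ) (closedBall c ℓ) := by
  intro x hx
  by_cases hxc : x = c
  · -- continuity at the centre
    subst hxc
    -- a bound for `‖φ q - v₀‖` on the compact boundary
    obtain ⟨K, hK⟩ : ∃ K, ∀ q ∈ sphere x ℓ, ‖φ q - v₀‖ ≤ K :=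
      (isCompact_sphere x ℓ).exists_bound_of_continuousOn (hφ.sub continuousOn_const)
    -- `‖cone y - v₀‖ ≤ (K / ℓ) · dist y x` for every `y`
    have hbound : ∀ y, ‖cone x ℓ v₀ φ y - v₀‖ ≤ K / ℓ * dist y x := fun y ↦ by
      have heq : cone x ℓ v₀ φ y - v₀ = radial x ℓ y • (φ (proj x ℓ y) - v₀) := by
        rw [cone_apply, smul_sub, sub_smul, one_smul]
        abel
      calc ‖cone x ℓ v₀ φ y - v₀‖ = dist y x / ℓ * ‖φ (proj x ℓ y) - v₀‖ := by
            rw [heq, norm_smul, Real.norm_eq_abs, abs_of_nonneg (radial_nonneg hℓ y), radial_def]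
        _ ≤ dist y x / ℓ * K := by
            gcongr
            exact hK _ (proj_mem_sphere hℓ y)
        _ = K / ℓ * dist y x := by ring
    have hlim : Tendsto (fun y ↦ K / ℓ * dist y x) (𝓝 x) (𝓝 0) := by
      have hc' : Continuous fun y : ℝ × ℝ ↦ K / ℓ * dist y x := by fun_prop
      have h := hc'.tendsto x
      rw [dist_self, mul_zero] at h
      exact h
    have hca : ContinuousAt (cone x ℓ v₀ φ) x := by
      rw [ContinuousAt, cone_center, tendsto_iff_norm_sub_tendsto_zero]
      exact squeeze_zero (fun y ↦ norm_nonneg _) hbound hlim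
    exact hca.continuousWithinAt
  · exact (continuousOn_cone_diff hℓ hφ x hxc).mono_of_mem_nhdsWithin
      (mem_nhdsWithin_of_mem_nhds (isOpen_compl_singleton.mem_nhds hxc))

end ConeSquare

end Literature.Topology.FourManifolds
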